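import Summits.CriticalPhenomena.PercolationContinuityZ3.Theorems.PercNearOneGluingNoHeavyLowerTailCubicThreePointApexCasesA
import HarnessLib

/-!
# `NoHeavyLowerTail` (stmt-CriticalPhenomena-4575) — splitting the step hypothesis at `b`, part 2: Case C = van den Berg–Häggström–Kahn, LEMMA B isolated,
# and `Γ ≥ 0` on every weighted graph from LEMMA B + BHK

Support file (prover prim-ineq-gen-2 gen 3, new-inequality factory; `--supports stmt-CriticalPhenomena-4575`).  Continues `…ApexCasesA`.  No sorries; the two hypotheses are named
`def … : Prop`s exactly as `StepHyp` of `…CubicThreePointInduction`.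
* **Case C** (`m` forced-joined to `c`, `a` glued to neither `b` nor `c`; `b–c`-type edges): with `e` forced `b ~ c` avoiding `a` (`caseC_bc`, `caseC_Rdel`),
  `a ~ b ⟺ a ~ b ∨ a ~ c` before (`caseC_ab_iff`); the forced section is `bc|a ⊔ M` with `m¹ = t⁰+u₁⁰+u₂⁰`, `u₃¹ = q⁰+u₃⁰`, `n¹ = 0`, and `n′⁰ = 0` (the forced `b–c` path lies in the
  support and misses the cluster of `a`): `caseC_cells`; hence `Φ_e = u₁⁰u₂⁰ − q⁰n⁰` (`caseC_phi`), nonnegative by the hypothesis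
  `BHKStep` := `P(a|b|c)·P(abc ∧ b≁c in ω∖a) ≤ P(ab|c)·P(ac|b)` — van den Berg–Häggström–Kahn, Random Structures Algorithms 29 (2006), Thm 1.4, applied in `G − a` to the apex-attachment
  probabilities of the clusters of `b` and `c` given `b ≁ c`: a THEOREM in print, recorded as a hypothesis pending its formalization (0 exceptions in 41.3·10⁶ exact evaluations, ttrl2 `hms`).
* **Degenerate** (`a ~ b` and `c ~ m` forced): `Φ_e = 0` (`caseD_phi`).
* **LEMMA B** (`LemmaB`): `m` forced-joined to neither `a` nor `c` (`b–Steiner` edges) — OPEN; in transition masses (`…ApexStep.Phi_bEdge`)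
  `(α₁+β₁)γ₁ᴹ + α₃γ₃ + β₁γ₃ + α₃γ₂ᴺ + γ₁ᴹ(γ₂ᴺ+γ₂ᴹ) + α₃α₁ + γ₃(γ₁ᴹ+γ₂ᴹ) + γ₃δ ≥ α₃δ`; 0 violations on all 8 535 744 terminal–Steiner edge steps of all weighted graphs with `≤ 7` vertices
  (21 weight families, ttrl2 `hms` RESULT S2; equality only where `{α₃,γ₁ᴹ,γ₂ᴹ,δ}` carry all mass with `γ₁ᴹγ₂ᴹ = α₃δ`, or every product vanishes); every single-correction weakening is false;
  not in the cone of the published BHK/AG/Harris inequalities at the four-point level (memo HMAX-SPLIT.md §9, §11).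
THEOREM (`stepHypB_of_lemmaB`, `gamma_of_lemmaB`): `LemmaB V → BHKStep V → ∀ D K p ∈ [0,1] a b c, 0 ≤ Γ(law)` — Gladkov's `AG ≥ 0` sharpened by its exact star and triangle
defects, for every finite weighted graph, conditional on one four-point BHK-type lemma and on a published theorem.
[cite: GladkovZimin2024HK, §4 (forced edges)]; [cite: Gladkov2024StrongFKG, Cor. 4.2 (AG)]
-/

noncomputable section

namespace Summit.CriticalPhenomena.PercolationContinuityZ3.Theorems

namespace CubicThreePointApex

open Finset SimpleGraph Literature.Probability.Percolation.DecisionTree CubicThreePointStep CubicThreePointTerminal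

variable {V : Type*} [DecidableEq V]

/-! ### Case C: the edge joins `b`'s cluster to `c`'s cluster (`m` forced-joined to `c`, `a` to neither) — the defect is `u₁⁰u₂⁰ − q⁰n⁰` -/

/-- An edge avoiding `a` gives an `Rdel`-adjacency. [folklore] -/
theorem Rdel_insert_edge {K S : Finset (Sym2 V)} {a x m : V} (hxm : x ≠ m) (hxa : x ≠ a) (hma : m ≠ a) :
    Rdel (insert s(x, m) K) S a x m := by
  unfold Rdel
  refine Adj.reachable ?_
  rw [fromEdgeSet_adj]
  refine ⟨⟨?_, ?_⟩, hxm⟩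
  · rw [Finset.mem_union, Finset.mem_insert]; exact Or.inr (Or.inl rfl)
  · rw [Sym2.mem_iff]; push Not; exact ⟨hxa.symm, hma.symm⟩

/-- `Rdel` is symmetric and transitive. [folklore] -/
theorem Rdel.symm {K S : Finset (Sym2 V)} {a x y : V} (h : Rdel K S a x y) : Rdel K S a y x := Reachable.symm h
/-- `Rdel` is transitive. [folklore] -/
theorem Rdel.trans {K S : Finset (Sym2 V)} {a x y z : V} (h : Rdel K S a x y) (h' : Rdel K S a y z) : Rdel K S a x z :=
  Reachable.trans h h'

section CaseC

variable {D K : Finset (Sym2 V)} {p : Sym2 V → ℝ} {a b c x m : V} (hxm : x ≠ m)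
  (hbx : ∀ S : Finset (Sym2 V), R K S b x) (hcm : ∀ S : Finset (Sym2 V), R K S c m)
include hxm hbx hcm

/-- With `e = {x,m}` forced, `b ~ c`. [folklore] -/
theorem caseC_bc (S : Finset (Sym2 V)) : R (insert s(x, m) K) S b c :=
  ((R_mono_insert _ (hbx S)).trans (R_insert_edge hxm)).trans (R_mono_insert _ (hcm S)).symm

/-- … and `b ~ c` avoiding `a` (the forced paths miss `a`). [folklore] -/
theorem caseC_Rdel (hab0 : ¬ R K ∅ a b) (hac0 : ¬ R K ∅ a c) (S : Finset (Sym2 V)) : Rdel (insert s(x, m) K) S a b c := by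
  have hxa : x ≠ a := fun h => hab0 (h ▸ (hbx ∅)).symm
  have hma : m ≠ a := fun h => hac0 (h ▸ (hcm ∅)).symm
  have h1 : Rdel K ∅ a b x := Rdel_of_R_of_not (hbx ∅) hab0
  have h2 : Rdel K ∅ a c m := Rdel_of_R_of_not (hcm ∅) hac0
  have h1' : Rdel (insert s(x, m) K) S a b x := Rdel_mono_insert _ (Rdel_mono_config (Finset.empty_subset S) h1)
  have h2' : Rdel (insert s(x, m) K) S a c m := Rdel_mono_insert _ (Rdel_mono_config (Finset.empty_subset S) h2)
  exact (h1'.trans (Rdel_insert_edge hxm hxa hma)).trans h2'.symm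

/-- With `e` forced, `a ~ b` iff `a ~ b` or `a ~ c` before. [folklore] -/
theorem caseC_ab_iff (S : Finset (Sym2 V)) : R (insert s(x, m) K) S a b ↔ R K S a b ∨ R K S a c := by
  constructor
  · intro h
    rcases reach_insert_cases h with h | ⟨h1, h2⟩ | ⟨h1, h2⟩
    · exact Or.inl h
    · exact Or.inl (h1.trans (hbx S).symm)
    · exact Or.inr (h1.trans (hcm S).symm)
  · rintro (h | h)
    · exact R_mono_insert _ h
    · exact (R_mono_insert _ h).trans (caseC_bc hxm hbx hcm S).symm

/-- Case C, the cells of the forced section and of the closed section. [folklore] -/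
theorem caseC_cells (hab0 : ¬ R K ∅ a b) (hac0 : ¬ R K ∅ a c) (D : Finset (Sym2 V)) (p : Sym2 V → ℝ) :
    PrW D p (evW (insert s(x, m) (D ∪ K)) (insert s(x, m) K) a b c) = 0 ∧
      PrW D p (evNp (insert s(x, m) (D ∪ K)) (insert s(x, m) K) a b c) = 0 ∧
      PrW D p (evU₁ (insert s(x, m) K) a b c) = 0 ∧ PrW D p (evU₂ (insert s(x, m) K) a b c) = 0 ∧
      PrW D p (evN (insert s(x, m) K) a b c) = 0 ∧
      PrW D p (evM (insert s(x, m) K) a b c) = PrW D p (evT K a b c) + PrW D p (evU₁ K a b c) + PrW D p (evU₂ K a b c) ∧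
      PrW D p (evU₃ (insert s(x, m) K) a b c) = PrW D p (evQ K a b c) + PrW D p (evU₃ K a b c) ∧
      PrW D p (evNp (insert s(x, m) (D ∪ K)) K a b c) = 0 := by
  have hbc := caseC_bc hxm hbx hcm
  have hrd := caseC_Rdel hxm hbx hcm hab0 hac0
  have hiff := caseC_ab_iff (a := a) hxm hbx hcm
  refine ⟨PrW_eq_zero_of_forall D p (fun S _ h => h.1.2.2 (hbc S)), PrW_eq_zero_of_forall D p (fun S _ h => h.1.2.2 (hbc S)),
    PrW_eq_zero_of_forall D p (fun S _ (h : S ∈ evU₁ _ a b c) => h.2 (h.1.trans (hbc S))),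
    PrW_eq_zero_of_forall D p (fun S _ (h : S ∈ evU₂ _ a b c) => h.2 (h.1.trans (hbc S).symm)),
    PrW_eq_zero_of_forall D p (fun S _ (h : S ∈ evN _ a b c) => h.2.2 (hrd S)), ?_, ?_, ?_⟩
  · refine PrW_of_ind_add3 D p fun S _ => ?_
    have key : S ∈ evM (insert s(x, m) K) a b c ↔ (S ∈ evT K a b c ∨ S ∈ evU₁ K a b c ∨ S ∈ evU₂ K a b c) := by
      rw [mem_evM, mem_evT, mem_evU₁, mem_evU₂]
      constructor
      · rintro ⟨h1, _, _⟩
        rcases (hiff S).1 h1 with h | h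
        · by_cases hac : R K S a c
          · exact Or.inl ⟨h, hac⟩
          · exact Or.inr (Or.inl ⟨h, hac⟩)
        · by_cases hab : R K S a b
          · exact Or.inl ⟨hab, h⟩
          · exact Or.inr (Or.inr ⟨h, hab⟩)
      · intro h
        have hab1 : R (insert s(x, m) K) S a b := by
          rcases h with ⟨h1, _⟩ | ⟨h1, _⟩ | ⟨h1, _⟩
          · exact (hiff S).2 (Or.inl h1)
          · exact (hiff S).2 (Or.inl h1)
          · exact (hiff S).2 (Or.inr h1)
        exact ⟨hab1, hab1.trans (hbc S), hrd S⟩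
    by_cases hM : S ∈ evM (insert s(x, m) K) a b c
    · rcases key.1 hM with h | h | h
      · rw [ind_of_mem hM, ind_of_mem h, ind_of_not_mem (show S ∉ evU₁ K a b c from fun h' => h'.2 h.2),
          ind_of_not_mem (show S ∉ evU₂ K a b c from fun h' => h'.2 h.1)]; ring
      · rw [ind_of_mem hM, ind_of_mem h, ind_of_not_mem (show S ∉ evT K a b c from fun h' => h.2 h'.2),
          ind_of_not_mem (show S ∉ evU₂ K a b c from fun h' => h'.2 h.1)]; ring
      · rw [ind_of_mem hM, ind_of_mem h, ind_of_not_mem (show S ∉ evT K a b c from fun h' => h.2 h'.1),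
          ind_of_not_mem (show S ∉ evU₁ K a b c from fun h' => h.2 h'.1)]; ring
    · have h1 : S ∉ evT K a b c := fun h => hM (key.2 (Or.inl h))
      have h2 : S ∉ evU₁ K a b c := fun h => hM (key.2 (Or.inr (Or.inl h)))
      have h3 : S ∉ evU₂ K a b c := fun h => hM (key.2 (Or.inr (Or.inr h)))
      rw [ind_of_not_mem hM, ind_of_not_mem h1, ind_of_not_mem h2, ind_of_not_mem h3]; ring
  · refine PrW_of_ind_add D p fun S _ => ?_
    have key : S ∈ evU₃ (insert s(x, m) K) a b c ↔ (S ∈ evQ K a b c ∨ S ∈ evU₃ K a b c) := by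
      rw [mem_evU₃, mem_evQ, mem_evU₃, hiff S]
      constructor
      · rintro ⟨_, h⟩
        have h' := not_or.mp h
        by_cases hbc' : R K S b c
        · exact Or.inr ⟨hbc', h'.1⟩
        · exact Or.inl ⟨h'.1, h'.2, hbc'⟩
      · rintro (⟨h1, h2, _⟩ | ⟨h1, h2⟩)
        · exact ⟨hbc S, fun h => h.elim h1 h2⟩
        · exact ⟨hbc S, fun h => h.elim h2 (fun hac => h2 (hac.trans h1.symm))⟩
    by_cases hU : S ∈ evU₃ (insert s(x, m) K) a b c
    · rcases key.1 hU with h | h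
      · rw [ind_of_mem hU, ind_of_mem h, ind_of_not_mem (show S ∉ evU₃ K a b c from fun h' => h.2.2 h'.1)]; ring
      · rw [ind_of_mem hU, ind_of_mem h, ind_of_not_mem (show S ∉ evQ K a b c from fun h' => h'.2.2 h.1)]; ring
    · have h1 : S ∉ evQ K a b c := fun h => hU (key.2 (Or.inl h))
      have h2 : S ∉ evU₃ K a b c := fun h => hU (key.2 (Or.inr h))
      rw [ind_of_not_mem hU, ind_of_not_mem h1, ind_of_not_mem h2]; ring
  · refine PrW_eq_zero_of_forall D p fun S hS h => ?_
    obtain ⟨hQ, hsep⟩ := h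
    refine not_Sep_of_reach (K' := insert s(x, m) K) (hbc S) (fun f hf => ?_) (fun z hz haz => ?_) hsep
    · rw [Finset.mem_union, Finset.mem_insert] at hf
      rw [Finset.mem_insert, Finset.mem_union]
      rcases hf with hf | rfl | hf
      · exact Or.inr (Or.inl (hS hf))
      · exact Or.inl rfl
      · exact Or.inr (Or.inr hf)
    · have : R (insert s(x, m) K) S a b := (R_mono_insert _ haz).trans hz.symm
      rcases (hiff S).1 this with h | h
      · exact hQ.1 h
      · exact hQ.2.1 h

/-- **Case C** (`m` forced-joined to `c`, `a` glued to neither `b` nor `c`: a `b–c`-type edge): the chord defect is `u₁⁰u₂⁰ − q⁰n⁰`,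
nonnegative by van den Berg–Häggström–Kahn's inequality (hypothesis `BHKStep`). [folklore] -/
theorem caseC_phi (hab0 : ¬ R K ∅ a b) (hac0 : ¬ R K ∅ a c) (D : Finset (Sym2 V)) (p : Sym2 V → ℝ)
    (hB : PrW D p (evQ K a b c) * PrW D p (evN K a b c) ≤ PrW D p (evU₁ K a b c) * PrW D p (evU₂ K a b c)) :
    0 ≤ PhiW (insert s(x, m) (D ∪ K)) D p K (insert s(x, m) K) a b c := by
  obtain ⟨cW, cNp, c1, c2, cN, cM, c3, cNp0⟩ := caseC_cells hxm hbx hcm hab0 hac0 D p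
  have hQ := PrW_evQ D p (insert s(x, m) (D ∪ K)) K a b c
  have key : PhiW (insert s(x, m) (D ∪ K)) D p K (insert s(x, m) K) a b c =
      PrW D p (evU₁ K a b c) * PrW D p (evU₂ K a b c) - PrW D p (evQ K a b c) * PrW D p (evN K a b c) := by
    unfold PhiW GamW
    rw [cW, cNp, c1, c2, cN, cM, c3, cNp0, hQ, cNp0, PrW_evT D p K a b c]
    simp only [GamB, GamR]
    ring
  rw [key]
  linarith

end CaseC

/-! ### The degenerate case (`a` and `b` glued, `m` glued to `c`): the defect vanishes -/

/-- If `a ~ b` and `c ~ m` are forced (and `x ~ b`), both sections are degenerate and `Φ_e = 0`. [folklore] -/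
theorem caseD_phi {D K : Finset (Sym2 V)} (p : Sym2 V → ℝ) {a b c x m : V} (hxm : x ≠ m)
    (hbx : ∀ S : Finset (Sym2 V), R K S b x) (hcm : ∀ S : Finset (Sym2 V), R K S c m) (hab : ∀ S : Finset (Sym2 V), R K S a b)
    (E : Finset (Sym2 V)) :
    PhiW E D p K (insert s(x, m) K) a b c = 0 := by
  have hab1 : ∀ S, R (insert s(x, m) K) S a b := fun S => R_mono_insert _ (hab S)
  have hbc1 : ∀ S, R (insert s(x, m) K) S b c := fun S =>
    ((R_mono_insert _ (hbx S)).trans (R_insert_edge hxm)).trans (R_mono_insert _ (hcm S)).symm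
  have z1 : PrW D p (evW E K a b c) = 0 := PrW_eq_zero_of_forall D p (fun S _ h => h.1.1 (hab S))
  have z2 : PrW D p (evNp E K a b c) = 0 := PrW_eq_zero_of_forall D p (fun S _ h => h.1.1 (hab S))
  have z3 : PrW D p (evU₂ K a b c) = 0 := PrW_eq_zero_of_forall D p (fun S _ (h : S ∈ evU₂ K a b c) => h.2 (hab S))
  have z4 : PrW D p (evU₃ K a b c) = 0 := PrW_eq_zero_of_forall D p (fun S _ (h : S ∈ evU₃ K a b c) => h.2 (hab S))
  have y1 : PrW D p (evW E (insert s(x, m) K) a b c) = 0 := PrW_eq_zero_of_forall D p (fun S _ h => h.1.1 (hab1 S))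
  have y2 : PrW D p (evNp E (insert s(x, m) K) a b c) = 0 := PrW_eq_zero_of_forall D p (fun S _ h => h.1.1 (hab1 S))
  have y3 : PrW D p (evU₁ (insert s(x, m) K) a b c) = 0 :=
    PrW_eq_zero_of_forall D p (fun S _ (h : S ∈ evU₁ _ a b c) => h.2 (h.1.trans (hbc1 S)))
  have y4 : PrW D p (evU₂ (insert s(x, m) K) a b c) = 0 :=
    PrW_eq_zero_of_forall D p (fun S _ (h : S ∈ evU₂ _ a b c) => h.2 (hab1 S))
  have y5 : PrW D p (evU₃ (insert s(x, m) K) a b c) = 0 :=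
    PrW_eq_zero_of_forall D p (fun S _ (h : S ∈ evU₃ _ a b c) => h.2 (hab1 S))
  unfold PhiW GamW
  rw [z1, z2, z3, z4, y1, y2, y3, y4, y5]
  simp only [GamB, GamR]
  ring

/-! ### LEMMA B, the BHK hypothesis, and the assembled step hypothesis -/

/-- **LEMMA B (open).**  The step hypothesis at `b` restricted to `b–STEINER` edges: `e = {x,m}`, `x` forced-joined to `b`, `m` forced-joined to
NEITHER `a` NOR `c`.  In transition masses: `(α₁+β₁)γ₁ᴹ + α₃γ₃ + β₁γ₃ + α₃γ₂ᴺ + γ₁ᴹ(γ₂ᴺ+γ₂ᴹ) + α₃α₁ + γ₃(γ₁ᴹ+γ₂ᴹ) + γ₃δ ≥ α₃δ` (`…ApexStep.Phi_bEdge`);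
a four-point conditional-correlation inequality of van den Berg–Häggström–Kahn type; 0 violations in ttrl2's exhaustive census (all weighted graphs on ≤ 7
vertices, 21 weight families); not in the cone of the published BHK/AG/Harris inequalities (memo HMAX-SPLIT.md §9, §11). [folklore] -/
def LemmaB (V : Type*) [DecidableEq V] : Prop :=
  ∀ (D K : Finset (Sym2 V)) (p : Sym2 V → ℝ), (∀ i, 0 ≤ p i) → (∀ i, p i ≤ 1) →
    ∀ (a b c x m : V), x ≠ m → (∀ S : Finset (Sym2 V), R K S b x) → ¬ R K ∅ a m → ¬ R K ∅ c m →
      0 ≤ PhiW (insert s(x, m) (D ∪ K)) D p K (insert s(x, m) K) a b c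

/-- **The van den Berg–Häggström–Kahn step** (finitary form of RSA 2006, Thm 1.4, applied in `G − a` to the apex-attachment probabilities of the
clusters of `b` and `c` given `b ≁ c`): `P(a|b|c)·P(abc ∧ b≁c in ω∖a) ≤ P(ab|c)·P(ac|b)` for every weighted graph with forced edges.  A THEOREM in print
(J. van den Berg, O. Häggström, J. Kahn, Random Structures Algorithms 29 (2006), Thm 1.4), recorded here as a hypothesis pending its formalization;
0 exceptions in 41.3·10⁶ exact evaluations (ttrl2). [folklore] -/
def BHKStep (V : Type*) [DecidableEq V] : Prop :=
  ∀ (D K : Finset (Sym2 V)) (p : Sym2 V → ℝ), (∀ i, 0 ≤ p i) → (∀ i, p i ≤ 1) → ∀ (a b c : V),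
    PrW D p (evQ K a b c) * PrW D p (evN K a b c) ≤ PrW D p (evU₁ K a b c) * PrW D p (evU₂ K a b c)

/-- **LEMMA B ∧ BHK ⟹ the step hypothesis at `b`** (case analysis on where `m` is glued: to `a` — Case A, proved; to `c` — Case C = BHK, or
degenerate; to neither — LEMMA B). [folklore] -/
theorem stepHypB_of_lemmaB (hL : LemmaB V) (hB : BHKStep V) : StepHypB V := by
  intro D K p hp0 hp1 a b c x m hxm hbx
  by_cases ham : R K ∅ a m
  · exact caseA_phi hxm hbx (fun S => R_mono_config (Finset.empty_subset S) ham) _ D hp0 hp1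
  · by_cases hcm : R K ∅ c m
    · have hcm' : ∀ S : Finset (Sym2 V), R K S c m := fun S => R_mono_config (Finset.empty_subset S) hcm
      by_cases hab : R K ∅ a b
      · exact (caseD_phi p hxm hbx hcm' (fun S => R_mono_config (Finset.empty_subset S) hab) _).ge
      · have hac : ¬ R K ∅ a c := fun h => ham (h.trans hcm)
        exact caseC_phi hxm hbx hcm' hab hac D p (hB D K p hp0 hp1 a b c)
    · exact hL D K p hp0 hp1 a b c x m hxm hbx ham hcm

section Main

variable {p : Sym2 V → ℝ} (hp0 : ∀ i, 0 ≤ p i) (hp1 : ∀ i, p i ≤ 1)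
include hp0 hp1

/-- **THEOREM (conditional on LEMMA B and on van den Berg–Häggström–Kahn's Thm 1.4).**  For every finite weighted graph with forced edges and
every apex/terminal triple, `Γ = P(a|b|c)P(abc) − P(ab|c)P(ac|b) − P(bc|a)·[P(ab|c)+P(ac|b)+n+n′] ≥ 0` — Gladkov's `AG ≥ 0` sharpened by its exact
star and triangle defects. [folklore] -/
theorem gamma_of_lemmaB (hL : LemmaB V) (hB : BHKStep V) (D K : Finset (Sym2 V)) (a b c : V) :
    0 ≤ Gam (PrW D p (evQ K a b c)) (PrW D p (evU₁ K a b c)) (PrW D p (evU₂ K a b c)) (PrW D p (evU₃ K a b c))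
        (PrW D p (evT K a b c)) (PrW D p (evN K a b c)) (PrW D p (evNp (D ∪ K) K a b c)) :=
  gamma_of_stepHypB hp0 hp1 (stepHypB_of_lemmaB hL hB) D K a b c

end Main

end CubicThreePointApex

end Summit.CriticalPhenomena.PercolationContinuityZ3.Theorems
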